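import Literature.Analysis.FluidPDE.LinearisedNSFourierForcedSynthesis
import Literature.Analysis.FluidPDE.NavierStokesCorrectorAntidivergence
import Literature.Analysis.FluidPDE.PassiveScalarWellPosednessProofs
import HarnessLib

/-!
# The synthesized field solves the linearised Navier–Stokes equation with a source on `[0, T] × T^d`

Analysis/FluidPDE proof file, seventh of the files `LinearisedNSFourierForced*` (objects in
`LinearisedNSFourierForcedDefs`; synthesis in `LinearisedNSFourierForcedSynthesis`), the
inhomogeneous twin of `LinearisedNSFourierSolution`. For `ν > 0`, `T > 0`, a background velocity
`u` jointly smooth and divergence free on `[0, T] × T^d`, a source `g` jointly smooth on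
`[0, T] × T^d` with mean-zero slices, and a smooth, divergence-free, mean-zero datum `w₀`, the
real fields `w = velF ν T u g w₀`, `q = presF ν T u g w₀` solve the **linearised Navier–Stokes
system along `u` with source `g`** (Constantin–Foias 1988, Ch. 14, (14.3)–(14.4) with an
inhomogeneity — the second-variation equation of the semiflow; Temam 1997, Ch. VI §8):

  `∂ₜw + (u·∇)w + (w·∇)u = νΔw - ∇q + g` on `[0, T]` (one-sided time derivative within `[0, T]`),
  `div w(t) = 0`, `∫ w(t) = 0 = ∫ q(t)`, `w(0) = w₀`,

with `w`, `q` jointly smooth on `[0, T] × T^d` (`velF_isSolution`, `exists_solutionF_Icc`):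

* **momentum** (`momentum_complexF`): for each component `l` and `t ∈ [0, T]` the complex defect
  `∂ₜVₗ + ∑ⱼ (uⱼ∂ⱼVₗ + Vⱼ∂ⱼuₗ) + ∂ₗQ - νΔVₗ - gₗ` is continuous with Fourier coefficients
  `-(P linSym)ₗ + (P G)ₗ + (linSymₗ - Gₗ) + 2πikₗ q̂ = 0` (the dictionary of
  `LinearisedNSFourierForcedSynthesis`, products ↦ lattice convolutions, and the pressure
  identity `presCoefF_pressure_identity` for `q̂ = -(∑ₘ kₘ (linSymₘ - Gₘ))/(2πi|k|²)`), hence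
  vanishes; the data being real, the real part is the real componentwise identity for
  `w = Re V`, `q = Re Q`, and the vector identity follows;
* **incompressibility**, **zero means**, **datum**: exactly as in the homogeneous file.

## References

* P. Constantin, C. Foias, *Navier–Stokes Equations*, Univ. Chicago Press 1988, Ch. 14, (14.3)–(14.4). [`ConstantinFoiasNSE1988`]
* R. Temam, *Infinite-Dimensional Dynamical Systems in Mechanics and Physics*, 2nd ed. (1997),
  Ch. VI §3.1, (3.7)–(3.11), §8. [`Temam1997`]
* L. Grafakos, *Classical Fourier Analysis*, 3rd ed. (2014), Prop. 3.2.4, 3.2.6 (8), §3.3.1. [`Grafakos2014`]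
-/

noncomputable section

open MeasureTheory Real Set Filter Topology UnitAddTorus

namespace Literature.Analysis.FluidPDE

namespace LinearisedNSFourier

open scoped ContDiff
open ScalarFourier
open CorrectorFourier (leraySym compC compC_apply driftCoeff driftCoeff_apply isSmoothSpaceTimeOn_compC
  sum_dsym_mul_eq_zero)
open FourierNS (HasDecay clamp)
open Literature.Analysis.FunctionSpaces.Torus (freqNormSq IsSmoothSpaceTimeOn IsSmooth partialDeriv
  laplacian timeDerivWithin gradient convect)

variable {d : Type*} [Fintype d] [DecidableEq d]
variable {ν T : ℝ} {u g : ℝ → UnitAddTorus d → EuclideanSpace ℝ d}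
  {w₀ : UnitAddTorus d → EuclideanSpace ℝ d}

/-- **The pressure identity of the forced equation**:
`-(P linSym)ₗ + (P G)ₗ + (linSymₗ - Gₗ) + 2πikₗ · presCoefF = 0` at every frequency
(`leray_pressure_identity` for the family `linSym - G`: the Fourier form of `ℙ = 1 - ∇Δ⁻¹div`,
Lemarié-Rieusset 2016, §6.1). [folklore] -/
theorem presCoefF_pressure_identity (U G₀ c : d → (d → ℤ) → ℂ) (l : d) (k : d → ℤ) :
    -linProjSym U c l k + srcProj G₀ l k + (linSym U c l k - G₀ l k) +
      dsym l k * presCoefF U G₀ c k = 0 := by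
  have h := leray_pressure_identity (fun m => linSym U c m k - G₀ m k) l k
  have hsplit : ∑ m, leraySym l m k * (linSym U c m k - G₀ m k) =
      linProjSym U c l k - srcProj G₀ l k := by
    rw [linProjSym_apply, srcProj_apply, ← Finset.sum_sub_distrib]
    refine Finset.sum_congr rfl fun m _ => ?_
    ring
  rw [hsplit] at h
  rw [presCoefF_apply]
  linear_combination h

-- one long verification; the coefficient bookkeeping elaborates slowly
set_option maxHeartbeats 1600000 in
/-- **The complex momentum equation with source, componentwise.** For `t ∈ [0, T]`, every
component `l` and point `x`:
`∂ₜVₗ + ∑ⱼ (uⱼ ∂ⱼVₗ + Vⱼ ∂ⱼuₗ) + ∂ₗQ - νΔVₗ - (gₗ : ℂ) = 0` for the synthesized complex fields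
`V = velCF ν T u g w₀`, `Q = presCF ν T u g w₀` (the continuous defect has vanishing Fourier
coefficients: `-νₖcₗ - (P linSym)ₗ + (P G)ₗ + linSymₗ + 2πikₗq̂ + 4π²ν|k|²cₗ - Gₗ = 0` by
`presCoefF_pressure_identity`; Grafakos 2014, Prop. 3.2.4). [folklore] -/
theorem momentum_complexF (hν : 0 < ν) (hT : 0 < T) (hu : IsSmoothSpaceTimeOn (Icc 0 T) u)
    (hdiv : ∀ t ∈ Icc 0 T, FunctionSpaces.Torus.IsDivFree (u t)) (hg : IsSmoothSpaceTimeOn (Icc 0 T) g)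
    (hgmean : ∀ t ∈ Icc 0 T, FunctionSpaces.Torus.HasZeroMean (g t)) (hw₀ : IsSmooth w₀)
    (hw₀div : FunctionSpaces.Torus.IsDivFree w₀) (hw₀mean : FunctionSpaces.Torus.HasZeroMean w₀)
    (l : d) {t : ℝ} (ht : t ∈ Icc 0 T) (x : UnitAddTorus d) :
    timeDerivWithin (Icc 0 T) (velCF ν T u g w₀ l) t x +
      (∑ j, (compC u j t x * partialDeriv j (velCF ν T u g w₀ l t) x +
        velCF ν T u g w₀ j t x * partialDeriv j (compC u l t) x)) +
      partialDeriv l (presCF ν T u g w₀ t) x - (ν : ℂ) * laplacian (velCF ν T u g w₀ l t) x -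
      compC g l t x = 0 := by
  obtain ⟨-, hdecay, -, -, -, -, -⟩ := solCoeffF_spec hν hT hu hdiv hg hgmean hw₀ hw₀div hw₀mean
  obtain ⟨hV, hQ, -, -, hcV, hcVt, hcQ, -, -⟩ := synthF_spec hν hT hu hdiv hg hgmean hw₀ hw₀div hw₀mean
  have hUS : UniqueDiffOn ℝ (Icc 0 T) := uniqueDiffOn_Icc hT
  -- notation
  set c := solCoeffF ν T u g w₀ with hc
  set U := driftCoeff T u with hU
  set Gc := driftCoeff T g with hGc
  set V := velCF ν T u g w₀ with hVdef
  set Qc := presCF ν T u g w₀ with hQcdef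
  -- smoothness of slices
  have hVt : ∀ l, IsSmooth (V l t) := fun l => (hV l).isSmooth_slice ht
  have hQt : IsSmooth (Qc t) := hQ.isSmooth_slice ht
  have hcompC : ∀ j, IsSmoothSpaceTimeOn (Icc 0 T) (compC u j) := isSmoothSpaceTimeOn_compC hu
  have hcompCt : ∀ j, IsSmooth (compC u j t) := fun j => (hcompC j).isSmooth_slice ht
  have hcompCg : ∀ j, IsSmoothSpaceTimeOn (Icc 0 T) (compC g j) := isSmoothSpaceTimeOn_compC hg
  have hcompCgt : ∀ j, IsSmooth (compC g j t) := fun j => (hcompCg j).isSmooth_slice ht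
  -- summability of coefficients
  obtain ⟨C₀, -, hC₀⟩ := hdecay (latOrder d)
  have hsumc : ∀ l, Summable fun k => ‖c l t k‖ := fun l => summable_norm_of_hasDecay le_rfl (hC₀ l t)
  -- the dictionary at `t`
  have hcU : ∀ j m, mFourierCoeff (compC u j t) m = U j t m := by
    intro j m; rw [hU, driftCoeff_apply, FourierNS.clamp_of_mem ht]
  have hcG : ∀ j m, mFourierCoeff (compC g j t) m = Gc j t m := by
    intro j m; rw [hGc, driftCoeff_apply, FourierNS.clamp_of_mem ht]
  have hcVd : ∀ j l m, mFourierCoeff (partialDeriv j (V l t)) m = dsym j m * c l t m := by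
    intro j l m
    rw [FunctionSpaces.Torus.mFourierCoeff_partialDeriv (hVt l) j m, hcV, dsym_apply, smul_eq_mul]
  have hcVΔ : ∀ l m, mFourierCoeff (laplacian (V l t)) m = -((4 * π ^ 2 * freqNormSq m : ℝ) : ℂ) * c l t m := by
    intro l m
    rw [mFourierCoeff_laplacian (hVt l), hcV]
  have hcUd : ∀ j l m, mFourierCoeff (partialDeriv j (compC u l t)) m = dsym j m * U l t m := by
    intro j l m
    rw [FunctionSpaces.Torus.mFourierCoeff_partialDeriv (hcompCt l) j m, hcU l, dsym_apply, smul_eq_mul]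
  have hcQd : ∀ l m, mFourierCoeff (partialDeriv l (Qc t)) m = dsym l m * presCoeffFieldF ν T u g w₀ t m := by
    intro l m
    rw [FunctionSpaces.Torus.mFourierCoeff_partialDeriv hQt l m, hcQ t ht, dsym_apply, smul_eq_mul]
  -- products ↦ lattice convolutions
  have hsumV : ∀ j, Summable fun k => ‖mFourierCoeff (V j t) k‖ := by
    intro j; simp_rw [hcV]; exact hsumc j
  have hP2 : ∀ j l m, mFourierCoeff (fun x => compC u j t x * partialDeriv j (V l t) x) m =
      lconv (U j t) (fun n => dsym j n * c l t n) m := by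
    intro j l m
    rw [mFourierCoeff_mul (hcompCt j).continuous (summable_norm_mFourierCoeff (hcompCt j))
      ((hVt l).partialDeriv j).continuous]
    have h1 : (fun n => mFourierCoeff (compC u j t) n) = U j t := funext fun n => hcU j n
    have h2 : (fun n => mFourierCoeff (partialDeriv j (V l t)) n) = fun n => dsym j n * c l t n :=
      funext fun n => hcVd j l n
    rw [h1, h2]
  have hP3 : ∀ j l m, mFourierCoeff (fun x => V j t x * partialDeriv j (compC u l t) x) m =
      lconv (c j t) (fun n => dsym j n * U l t n) m := by
    intro j l m
    rw [mFourierCoeff_mul (hVt j).continuous (hsumV j) ((hcompCt l).partialDeriv j).continuous]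
    have h1 : (fun n => mFourierCoeff (V j t) n) = c j t := funext fun n => hcV j t n
    have h2 : (fun n => mFourierCoeff (partialDeriv j (compC u l t)) n) = fun n => dsym j n * U l t n :=
      funext fun n => hcUd j l n
    rw [h1, h2]
  -- the five terms as functions
  set T1 : UnitAddTorus d → ℂ := timeDerivWithin (Icc 0 T) (V l) t with hT1
  set T2 : UnitAddTorus d → ℂ := fun x => ∑ j, (compC u j t x * partialDeriv j (V l t) x +
    V j t x * partialDeriv j (compC u l t) x) with hT2
  set T3 : UnitAddTorus d → ℂ := partialDeriv l (Qc t) with hT3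
  set T4 : UnitAddTorus d → ℂ := fun x => (ν : ℂ) * laplacian (V l t) x with hT4
  set T5 : UnitAddTorus d → ℂ := compC g l t with hT5
  -- continuity
  have hT1c : Continuous T1 := (((hV l).timeDerivWithin hUS).isSmooth_slice ht).continuous
  have hprodc : ∀ j, Continuous fun x => compC u j t x * partialDeriv j (V l t) x +
      V j t x * partialDeriv j (compC u l t) x := fun j =>
    ((hcompCt j).continuous.mul ((hVt l).partialDeriv j).continuous).add
      ((hVt j).continuous.mul ((hcompCt l).partialDeriv j).continuous)
  have hT2c : Continuous T2 := continuous_finsetSum _ fun j _ => hprodc j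
  have hT3c : Continuous T3 := (hQt.partialDeriv l).continuous
  have hT4c : Continuous T4 := continuous_const.mul (hVt l).laplacian.continuous
  have hT5c : Continuous T5 := (hcompCgt l).continuous
  -- the defect and its coefficients
  have hEc : Continuous fun x => T1 x + T2 x + T3 x - T4 x - T5 x :=
    (((hT1c.add hT2c).add hT3c).sub hT4c).sub hT5c
  have hEcoeff : ∀ m, mFourierCoeff (fun x => T1 x + T2 x + T3 x - T4 x - T5 x) m = 0 := by
    intro m
    have i1 := hT1c.integrable_unitAddTorus
    have i2 := hT2c.integrable_unitAddTorus
    have i3 := hT3c.integrable_unitAddTorus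
    have i4 := hT4c.integrable_unitAddTorus
    have i5 := hT5c.integrable_unitAddTorus
    change mFourierCoeff ((((T1 + T2) + T3) - T4) - T5) m = 0
    rw [FunctionSpaces.Torus.mFourierCoeff_sub (((i1.add i2).add i3).sub i4) i5,
      FunctionSpaces.Torus.mFourierCoeff_sub ((i1.add i2).add i3) i4,
      FunctionSpaces.Torus.mFourierCoeff_add (i1.add i2) i3,
      FunctionSpaces.Torus.mFourierCoeff_add i1 i2]
    -- the coefficients of the five terms
    have e1 : mFourierCoeff T1 m = -(heatRate ν m : ℂ) * c l t m -
        linProjSym (fun j => U j t) (fun j => c j t) l m + srcProj (fun j => Gc j t) l m := hcVt l t ht m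
    have e2 : mFourierCoeff T2 m = linSym (fun j => U j t) (fun j => c j t) l m := by
      rw [hT2, FunctionSpaces.Torus.mFourierCoeff_finset_sum _ fun j _ => (hprodc j).integrable_unitAddTorus,
        linSym_apply, transportSym_apply, transportSym_apply, ← Finset.sum_add_distrib]
      refine Finset.sum_congr rfl fun j _ => ?_
      have ib : Integrable (fun x => compC u j t x * partialDeriv j (V l t) x) volume :=
        ((hcompCt j).continuous.mul ((hVt l).partialDeriv j).continuous).integrable_unitAddTorus
      have ic : Integrable (fun x => V j t x * partialDeriv j (compC u l t) x) volume :=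
        ((hVt j).continuous.mul ((hcompCt l).partialDeriv j).continuous).integrable_unitAddTorus
      change mFourierCoeff ((fun x => compC u j t x * partialDeriv j (V l t) x) +
        (fun x => V j t x * partialDeriv j (compC u l t) x)) m = _
      rw [FunctionSpaces.Torus.mFourierCoeff_add ib ic, hP2 j l m, hP3 j l m]
    have e3 : mFourierCoeff T3 m = dsym l m * presCoeffFieldF ν T u g w₀ t m := hcQd l m
    have e4 : mFourierCoeff T4 m = (ν : ℂ) * (-((4 * π ^ 2 * freqNormSq m : ℝ) : ℂ) * c l t m) := by
      rw [hT4, Torus.mFourierCoeff_const_mul', hcVΔ l m]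
    have e5 : mFourierCoeff T5 m = Gc l t m := hcG l m
    rw [e1, e2, e3, e4, e5, presCoeffFieldF_apply]
    have hid := presCoefF_pressure_identity (fun j => U j t) (fun j => Gc j t) (fun j => c j t) l m
    rw [heatRate_apply]
    push_cast
    linear_combination hid
  -- hence the defect vanishes
  exact Torus.eq_zero_of_forall_mFourierCoeff_eq_zero hEc hEcoeff x

-- one long verification; the coefficient bookkeeping elaborates slowly
set_option maxHeartbeats 1600000 in
/-- **The synthesized real fields solve the linearised Navier–Stokes equation with source on
`[0, T] × T^d`.** For `ν > 0`, `T > 0`, a background `u` jointly smooth and divergence free on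
`[0, T] × T^d`, a jointly smooth source `g` with mean-zero slices and a smooth divergence-free
mean-zero datum `w₀`, the fields `w = velF ν T u g w₀`, `q = presF ν T u g w₀` are jointly smooth
on `[0, T] × T^d`, `w(t)` is divergence free and mean zero, `q(t)` is mean zero,
`∂ₜw + (u·∇)w + (w·∇)u = νΔw - ∇q + g` holds pointwise on `[0, T]` with the one-sided time
derivative within `[0, T]`, and `w(0) = w₀` (Constantin–Foias 1988, Ch. 14, (14.3)–(14.4) with an
inhomogeneity; real parts of `momentum_complexF`). [cite: ConstantinFoiasNSE1988, Ch. 14 (14.3)–(14.4)] -/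
theorem velF_isSolution (hν : 0 < ν) (hT : 0 < T) (hu : IsSmoothSpaceTimeOn (Icc 0 T) u)
    (hdiv : ∀ t ∈ Icc 0 T, FunctionSpaces.Torus.IsDivFree (u t)) (hg : IsSmoothSpaceTimeOn (Icc 0 T) g)
    (hgmean : ∀ t ∈ Icc 0 T, FunctionSpaces.Torus.HasZeroMean (g t)) (hw₀ : IsSmooth w₀)
    (hw₀div : FunctionSpaces.Torus.IsDivFree w₀) (hw₀mean : FunctionSpaces.Torus.HasZeroMean w₀) :
    IsSmoothSpaceTimeOn (Icc 0 T) (velF ν T u g w₀) ∧ IsSmoothSpaceTimeOn (Icc 0 T) (presF ν T u g w₀) ∧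
    (∀ t ∈ Icc 0 T, FunctionSpaces.Torus.IsDivFree (velF ν T u g w₀ t)) ∧
    (∀ t ∈ Icc 0 T, FunctionSpaces.Torus.HasZeroMean (velF ν T u g w₀ t)) ∧
    (∀ t ∈ Icc 0 T, FunctionSpaces.Torus.HasZeroMean (presF ν T u g w₀ t)) ∧
    (∀ t ∈ Icc 0 T, ∀ x, timeDerivWithin (Icc 0 T) (velF ν T u g w₀) t x +
        convect (u t) (velF ν T u g w₀ t) x + convect (velF ν T u g w₀ t) (u t) x =
      ν • laplacian (velF ν T u g w₀ t) x - gradient (presF ν T u g w₀ t) x + g t x) ∧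
    velF ν T u g w₀ 0 = w₀ := by
  obtain ⟨-, hdecay, hdivF, hzero, -, -, -⟩ := solCoeffF_spec hν hT hu hdiv hg hgmean hw₀ hw₀div hw₀mean
  obtain ⟨hV, hQ, hvel, hpres, hcV, -, hcQ, -, hdatum⟩ :=
    synthF_spec hν hT hu hdiv hg hgmean hw₀ hw₀div hw₀mean
  have hUS : UniqueDiffOn ℝ (Icc 0 T) := uniqueDiffOn_Icc hT
  set c := solCoeffF ν T u g w₀ with hc
  set V := velCF ν T u g w₀ with hVdef
  set Qc := presCF ν T u g w₀ with hQcdef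
  set v := velF ν T u g w₀ with hv
  set q := presF ν T u g w₀ with hq
  -- the real fields are the real parts (as functions)
  have hvfun : ∀ l, (fun s y => (V l s y).re) = fun s y => v s y l := fun l => rfl
  have hvfun' : ∀ l t, (fun y => (V l t y).re) = fun y => v t y l := fun l t => rfl
  have hqfun : ∀ t, (fun y => (Qc t y).re) = q t := fun t => rfl
  have hufun : ∀ l t, compC u l t = fun y => ((u t y l : ℝ) : ℂ) := fun l t => rfl
  -- smoothness of slices
  have hvt : ∀ t ∈ Icc 0 T, IsSmooth (v t) := fun t ht => hvel.isSmooth_slice ht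
  have hut : ∀ t ∈ Icc 0 T, IsSmooth (u t) := fun t ht => hu.isSmooth_slice ht
  have hqt : ∀ t ∈ Icc 0 T, IsSmooth (q t) := fun t ht => hpres.isSmooth_slice ht
  have hVt : ∀ l, ∀ t ∈ Icc 0 T, IsSmooth (V l t) := fun l t ht => (hV l).isSmooth_slice ht
  have hQt : ∀ t ∈ Icc 0 T, IsSmooth (Qc t) := fun t ht => hQ.isSmooth_slice ht
  ------------------------------------------------------------------
  -- the real momentum equation, componentwise
  ------------------------------------------------------------------
  have hreal : ∀ l, ∀ t ∈ Icc 0 T, ∀ x,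
      timeDerivWithin (Icc 0 T) (fun s y => v s y l) t x +
        (∑ j, (u t x j * partialDeriv j (fun y => v t y l) x +
          v t x j * partialDeriv j (fun y => u t y l) x)) +
        partialDeriv l (q t) x - ν * laplacian (fun y => v t y l) x - g t x l = 0 := by
    intro l t ht x
    have h := congrArg Complex.re (momentum_complexF hν hT hu hdiv hg hgmean hw₀ hw₀div hw₀mean l ht x)
    rw [← hVdef, ← hQcdef] at h
    have hutl : ∀ j, IsSmooth (fun y => u t y j) := fun j => (hut t ht).apply j
    -- rewrite every real part
    have r1 : (timeDerivWithin (Icc 0 T) (V l) t x).re = timeDerivWithin (Icc 0 T) (fun s y => v s y l) t x := by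
      rw [← hvfun l]; exact (Torus.timeDerivWithin_re (hV l) hUS ht x).symm
    have r2 : ∀ j, (compC u j t x * partialDeriv j (V l t) x).re =
        u t x j * partialDeriv j (fun y => v t y l) x := by
      intro j
      rw [compC_apply, Complex.re_ofReal_mul, ← hvfun' l t, Torus.partialDeriv_re (hVt l t ht) j x]
    have r3 : ∀ j, (V j t x * partialDeriv j (compC u l t) x).re =
        v t x j * partialDeriv j (fun y => u t y l) x := by
      intro j
      rw [hufun l t, Torus.partialDeriv_ofReal (hutl l) j x, Complex.re_mul_ofReal]
      rfl
    have r4 : (partialDeriv l (Qc t) x).re = partialDeriv l (q t) x := by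
      rw [← hqfun t]; exact (Torus.partialDeriv_re (hQt t ht) l x).symm
    have r5 : ((ν : ℂ) * laplacian (V l t) x).re = ν * laplacian (fun y => v t y l) x := by
      rw [Complex.re_ofReal_mul, ← hvfun' l t, Torus.laplacian_re (hVt l t ht) x]
    have r6 : (compC g l t x).re = g t x l := by rw [compC_apply, Complex.ofReal_re]
    simp only [Complex.sub_re, Complex.add_re, Complex.re_sum, r1, r2, r3, r4, r5, r6, Complex.zero_re] at h
    exact h
  ------------------------------------------------------------------
  -- the clauses
  ------------------------------------------------------------------
  refine ⟨hvel, hpres, fun t ht x => ?_, fun t ht => ?_, fun t ht => ?_, fun t ht x => ?_, hdatum⟩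
  · -- incompressibility
    rw [FunctionSpaces.Torus.divergence]
    have hDc : Continuous fun y => ∑ l, partialDeriv l (V l t) y :=
      continuous_finsetSum _ fun l _ => ((hVt l t ht).partialDeriv l).continuous
    have hDcoeff : ∀ m, mFourierCoeff (fun y => ∑ l, partialDeriv l (V l t) y) m = 0 := by
      intro m
      rw [FunctionSpaces.Torus.mFourierCoeff_finset_sum _ fun l _ =>
        ((hVt l t ht).partialDeriv l).continuous.integrable_unitAddTorus]
      have hcVd : ∀ l, mFourierCoeff (partialDeriv l (V l t)) m = dsym l m * c l t m := fun l => by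
        rw [FunctionSpaces.Torus.mFourierCoeff_partialDeriv (hVt l t ht) l m, hcV, dsym_apply, smul_eq_mul]
      simp_rw [hcVd]
      exact sum_dsym_mul_eq_zero (c := fun l => c l t) (fun m => hdivF t m) m
    have hD0 := Torus.eq_zero_of_forall_mFourierCoeff_eq_zero hDc hDcoeff x
    have hre : ∑ l, partialDeriv l (fun y => v t y l) x = (∑ l, partialDeriv l (V l t) x).re := by
      rw [Complex.re_sum]
      refine Finset.sum_congr rfl fun l _ => ?_
      rw [← hvfun' l t, Torus.partialDeriv_re (hVt l t ht) l x]
    rw [hre, hD0, Complex.zero_re]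
  · -- zero mean of the velocity
    have hvs : IsSmooth (v t) := hvt t ht
    change ∫ x, v t x = 0
    ext l
    have hint : Integrable (v t) volume := hvs.integrable
    rw [show (∫ x, v t x) l = (EuclideanSpace.proj l : EuclideanSpace ℝ d →L[ℝ] ℝ) (∫ x, v t x) from rfl,
      ← ContinuousLinearMap.integral_comp_comm _ hint]
    change ∫ x, v t x l = (0 : EuclideanSpace ℝ d) l
    have hVint : Integrable (V l t) volume := (hVt l t ht).integrable
    have h1 : ∫ x, v t x l = (∫ x, V l t x).re := by
      have h2 := Complex.reCLM.integral_comp_comm hVint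
      simp only [Complex.reCLM_apply] at h2
      exact h2
    rw [h1, ← FunctionSpaces.Torus.mFourierCoeff_zero_eq_integral, hcV, hzero l t]
    rfl
  · -- zero mean of the pressure
    change ∫ x, q t x = 0
    have hQint : Integrable (Qc t) volume := (hQt t ht).integrable
    have h1 : ∫ x, q t x = (∫ x, Qc t x).re := by
      have h2 := Complex.reCLM.integral_comp_comm hQint
      simp only [Complex.reCLM_apply] at h2
      exact h2
    rw [h1, ← FunctionSpaces.Torus.mFourierCoeff_zero_eq_integral, hcQ t ht, presCoeffFieldF_apply,
      presCoefF_apply]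
    simp
  · -- momentum, as vectors
    have hvs : IsSmooth (v t) := hvt t ht
    have hus : IsSmooth (u t) := hut t ht
    have hqs : IsSmooth (q t) := hqt t ht
    ext l
    simp only [PiLp.sub_apply, PiLp.add_apply, PiLp.smul_apply, smul_eq_mul]
    rw [← Torus.timeDerivWithin_apply_comp hvel hUS ht x l, Torus.convect_apply_eq hvs,
      Torus.convect_apply_eq hus, FunctionSpaces.Torus.gradient_apply (hqs.isContDiff (by simp)),
      ← Torus.laplacian_apply_comp hvs]
    have h := hreal l t ht x
    rw [Finset.sum_add_distrib] at h
    linarith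

/-- **Existence of smooth solutions of the linearised Navier–Stokes equation with a source on
`[0, T] × T^d`.** For `ν > 0`, `T > 0`, `u` jointly smooth and divergence free on `[0, T] × T^d`,
`g` jointly smooth on `[0, T] × T^d` with mean-zero slices and a smooth divergence-free
mean-zero datum `w₀` there are `w`, `q` jointly smooth on `[0, T] × T^d` with `w(t)` divergence
free and mean zero, `q(t)` mean zero, `∂ₜw + (u·∇)w + (w·∇)u = νΔw - ∇q + g` on `[0, T]`, and
`w(0) = w₀` (Constantin–Foias 1988, Ch. 14, (14.3)–(14.4) with an inhomogeneity;
`velF_isSolution`). [cite: ConstantinFoiasNSE1988, Ch. 14 (14.3)–(14.4)] -/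
theorem exists_solutionF_Icc (hν : 0 < ν) (hT : 0 < T) (hu : IsSmoothSpaceTimeOn (Icc 0 T) u)
    (hdiv : ∀ t ∈ Icc 0 T, FunctionSpaces.Torus.IsDivFree (u t)) (hg : IsSmoothSpaceTimeOn (Icc 0 T) g)
    (hgmean : ∀ t ∈ Icc 0 T, FunctionSpaces.Torus.HasZeroMean (g t)) (hw₀ : IsSmooth w₀)
    (hw₀div : FunctionSpaces.Torus.IsDivFree w₀) (hw₀mean : FunctionSpaces.Torus.HasZeroMean w₀) :
    ∃ (w : ℝ → UnitAddTorus d → EuclideanSpace ℝ d) (q : ℝ → UnitAddTorus d → ℝ),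
      IsSmoothSpaceTimeOn (Icc 0 T) w ∧ IsSmoothSpaceTimeOn (Icc 0 T) q ∧
      (∀ t ∈ Icc 0 T, FunctionSpaces.Torus.IsDivFree (w t)) ∧
      (∀ t ∈ Icc 0 T, FunctionSpaces.Torus.HasZeroMean (w t)) ∧
      (∀ t ∈ Icc 0 T, FunctionSpaces.Torus.HasZeroMean (q t)) ∧
      (∀ t ∈ Icc 0 T, ∀ x, timeDerivWithin (Icc 0 T) w t x + convect (u t) (w t) x + convect (w t) (u t) x =
        ν • laplacian (w t) x - gradient (q t) x + g t x) ∧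
      w 0 = w₀ := by
  obtain ⟨h1, h2, h3, h4, h5, h6, h7⟩ := velF_isSolution hν hT hu hdiv hg hgmean hw₀ hw₀div hw₀mean
  exact ⟨velF ν T u g w₀, presF ν T u g w₀, h1, h2, h3, h4, h5, h6, h7⟩

end LinearisedNSFourier

end Literature.Analysis.FluidPDE

end
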